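import Summits.BirchSwinnertonDyer.BirchSwinnertonDyer.Theorems.SignedLowerHalvesKobayashiLowerHalfLargeImageBSTWTwistRecordShape
import HarnessLib

/-!
# Route `SignedLowerHalves`, crux `KobayashiLowerHalfLargeImage` (item stmt-BirchSwinnertonDyer-19001): the BSTW-TWIST
# SUB-FAMILY of class X7 — SHAPE OF THE PER-PAIR (NLR) CERTIFICATE (road B1″'s scope condition on the μ-step), from
# kernel-decidable point counts (cell `pub/bsd-litref`, paper sub-dir `bstw24`, prover seat `bsd-litref-bstw24-pv` gen 7;
# companion of `…BSTWTwistRecordShape.lean` p496534; a `--supports … --as helper` file; THEOREMS ONLY; closes nothing)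

HONEST FRAMING (programme BSD-LIT2PART v1 §HONESTY, verbatim): «no tranche here proves BSD; ARM L moves the LITERAL
column of an r ≤ 1 census into the kernel-proved-modulo-named-print column; ARM P changes what "named print" is
worth.» Burungale–Skinner–Tian–Wan arXiv:2409.01350v2 is an UNREFEREED PREPRINT and NOTHING of it is used here: every
theorem below is an UNCONDITIONAL arithmetic statement about two explicit Weierstrass equations and an integer `d`.
Records ≠ bookings; class X7 stays CONSTRUCTION-SHAPED; crux 3 stays OPEN; 0 cells move; typed ≠ proved ≠ endorsed.

WHAT (NLR) IS. On the 389-pair complement of the litref scope the twist clause of BSTW Thm. 1.3 / 1.5 / Cor. 10.2 runs on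
road B1/B1′ (referee C4 ROUND C4-R3-ADD-8: T1 PASS-in-cell; residual = the μ-step [tex L7421–7428] alone + GAP@3). The
μ-step's second half T2b for `g_K = g ⊗ χ_K` (level `N₀·d_K²`) is, on BOTH routes the readers found — [Moakher,
arXiv:2408.15410, Thm. 3.19] (sheet `pub/bsd-litref/bstw24/sheets/D-AUDIT-bstw24-r1-MOAKHER319.md` 0a37e349b2e0efc1) and
reader 1's road B1″ «twist the LEVEL STRUCTURE» ([PollackWeston2011, Thm. 6.8] for the UNTWISTED `g` at square-free `N₀`
+ the twisting-operator Lemma TW; `…-MOAKHER319-ADDENDUM-1.md` 4c9fbbb992e08e43) — available exactly under the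
NO-LEVEL-RAISING condition at the primes of `d_K`:
  (NLR_ℓ)  `ℓ ≢ 1 (mod p)` and `a_ℓ(E₀)² ≢ (ℓ + 1)² (mod p)`  for every prime `ℓ ∣ d_K`
(census, reader 1 and this seat independently, 0/415 differences: of the 271 complement pairs at `p ≥ 5`, 254 satisfy (NLR),
17 do not). Whether road B1″ is admitted is the desk's word (pending); (NLR) itself is plain arithmetic of the pair, and
THIS file gives its per-pair KERNEL CERTIFICATE a shape, so that a future scoped tier carrying the hypothesis
  `∀ (ℓ : ℕ) [Fact ℓ.Prime], RamifiedInQuadratic d ℓ → ℓ % p ≠ 1 ∧ ¬ (p : ℤ) ∣ W₀.frobeniusTrace ℓ ^ 2 − (ℓ + 1) ^ 2`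
is discharged per pair BY NAME:

* `frobeniusTrace_eq_of_countPoints` — `a_ℓ(W₀) = ℓ + 1 − countPoints [b] ℓ` at an odd good `ℓ` (the schema count of
  `X11RankOneCertificates`, `natCard_point_eq_of_countPoints`); `frobeniusTrace_two_eq_of_card` — `a₂(W₀) = 3 − (1 + #{affine
  𝔽₂-solutions})` (`natCard_point_eq_one_add_card`);
* `nlr_of_certs` — the (NLR) clause for the literal `W₀ = [b₁,…,b₆]` and a literal `d`, from a list `L` of pairs
  `(q, n_q)` covering the odd primes of `|d|` with `q` prime, odd, `q ∤ Δ₀`, `q % p ≠ 1`, `countPoints [b] q = n_q`,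
  `p ∤ (q + 1 − n_q)² − (q + 1)²`, and — only when `d ≢ 1 (mod 4)` — the same two checks at `2` on the 𝔽₂-count;
* `exists_twistBodyNLR_of_certs` — the BODY twist datum of `…BSTWTwistRecordShape.lean` (`exists_twistBody_of_certs`) WITH the
  (NLR) clause as an eighth conjunct, from the union of the two certificate lists (so a per-pair record is ONE theorem
  `twistNLR_x7bstw_<label>_<p>`, exactly like the scoped records' `twistAux_…`).

Design: THEOREMS ONLY; numerical hypotheses on `discOf` / `countPoints` / the 𝔽₂-count, discharged per record by `decide` /
`decide +kernel` / `norm_num`; default heartbeats; axioms standard.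
References: [BurungaleSkinnerTianWan2024] §10.3 (tex l.7421–7428; bookkeeping only); [PollackWeston2011] Thm. 6.8 (shape of
the hypothesis only); [SilvermanAEC2009] V.2 (a_ℓ = ℓ + 1 − #Ẽ(𝔽_ℓ)), VII.5 Prop. 5.1; [IrelandRosen1990] Prop. 5.1.2, §8.1.
-/

set_option autoImplicit false
set_option linter.dupNamespace false

noncomputable section

open scoped Classical

open WeierstrassCurve Literature.NumberTheory.EllipticCurves
  Literature.NumberTheory.EllipticCurves.Rank1Residual
  Literature.NumberTheory.EllipticCurves.Rank1Residual.X11RankOneCertificates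
  Literature.NumberTheory.EllipticCurves.BurungaleSkinnerTianWan2024
  Summit.BirchSwinnertonDyer.BirchSwinnertonDyer.Rank1Residual.IntModel
  Summit.BirchSwinnertonDyer.BirchSwinnertonDyer.Rank1Residual.X11RankOne
  Summit.BirchSwinnertonDyer.Rank1Residual.X11b
  Summit.BirchSwinnertonDyer.Rank1Residual.Supersingular
  Summit.BirchSwinnertonDyer.Rank1Residual.SecondDescent

namespace Summit.BirchSwinnertonDyer.BirchSwinnertonDyer.Theorems.X7Twist

/-! ### §1 `a_ℓ` of the literal model from the schema's point count -/

section Trace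

variable (b1 b2 b3 b4 b6 : ℤ) [hM : (⟨b1, b2, b3, b4, b6⟩ : WeierstrassCurve ℚ).IsGloballyMinimal]

/-- **`a_ℓ(W₀) = ℓ + 1 − countPoints [b] ℓ`** at an odd prime `ℓ ∤ Δ₀` for the literal globally minimal model
`W₀ = [b₁,…,b₆]` (`frobeniusTrace_eq` + `natCard_point_eq_of_countPoints`). [cite: SilvermanAEC2009, V.2 (a = q + 1 − #E(𝔽_q), PDF p. 147)]
[cite: IrelandRosen1990, Prop. 5.1.2 and §8.1] -/
theorem frobeniusTrace_eq_of_countPoints (ℓ : ℕ) [Fact ℓ.Prime] (hℓ2 : ℓ ≠ 2)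
    (hℓΔ : ¬ (ℓ : ℤ) ∣ discOf [b1, b2, b3, b4, b6]) {n : ℕ} (hc : countPoints [b1, b2, b3, b4, b6] ℓ = n) :
    (⟨b1, b2, b3, b4, b6⟩ : WeierstrassCurve ℚ).frobeniusTrace ℓ = (ℓ : ℤ) + 1 - n :=
  frobeniusTrace_eq (integralModelInt_lit b1 b2 b3 b4 b6) (natCard_point_eq_of_countPoints b1 b2 b3 b4 b6 ℓ hℓ2 hℓΔ hc)

/-- **`a₂(W₀) = 3 − (1 + #{affine 𝔽₂-solutions})`** for the literal globally minimal model when `2 ∤ Δ₀`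
(`natCard_point_eq_one_add_card`, decided over the four points of `𝔽₂²`). [cite: SilvermanAEC2009, V.2 (a = q + 1 − #E(𝔽_q), PDF p. 147)] -/
theorem frobeniusTrace_two_eq_of_card (h2Δ : ¬ (2 : ℤ) ∣ discOf [b1, b2, b3, b4, b6]) :
    (⟨b1, b2, b3, b4, b6⟩ : WeierstrassCurve ℚ).frobeniusTrace 2 = 3 - ((1 + Fintype.card {xy : ZMod 2 × ZMod 2 //
      xy.2 ^ 2 + ((⟨b1, b2, b3, b4, b6⟩ : WeierstrassCurve ℤ).map (Int.castRingHom (ZMod 2))).a₁ * xy.1 * xy.2 +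
        ((⟨b1, b2, b3, b4, b6⟩ : WeierstrassCurve ℤ).map (Int.castRingHom (ZMod 2))).a₃ * xy.2 =
      xy.1 ^ 3 + ((⟨b1, b2, b3, b4, b6⟩ : WeierstrassCurve ℤ).map (Int.castRingHom (ZMod 2))).a₂ * xy.1 ^ 2 +
        ((⟨b1, b2, b3, b4, b6⟩ : WeierstrassCurve ℤ).map (Int.castRingHom (ZMod 2))).a₄ * xy.1 +
        ((⟨b1, b2, b3, b4, b6⟩ : WeierstrassCurve ℤ).map (Int.castRingHom (ZMod 2))).a₆} : ℕ) : ℤ) := by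
  have hI := integralModelInt_lit b1 b2 b3 b4 b6
  have hΔ2 : ((⟨b1, b2, b3, b4, b6⟩ : WeierstrassCurve ℤ).map (Int.castRingHom (ZMod 2))).Δ ≠ 0 := by
    rw [WeierstrassCurve.map_Δ, intCurve_Δ]
    intro h
    exact h2Δ ((ZMod.intCast_zmod_eq_zero_iff_dvd _ 2).mp (by simpa using h))
  rw [frobeniusTrace_eq hI (natCard_point_eq_one_add_card _ hΔ2)]
  push_cast; ring

end Trace

/-! ### §2 The (NLR) clause of the literal pair from a certificate list -/

section NLR

variable (p : ℕ) [Fact p.Prime] (b1 b2 b3 b4 b6 : ℤ)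
  [hM : (⟨b1, b2, b3, b4, b6⟩ : WeierstrassCurve ℚ).IsGloballyMinimal]

omit [Fact p.Prime] in
/-- **The (NLR) clause for the literal `W₀ = [b₁,…,b₆]` and a literal square-free `d` from certificates.** For every prime
`ℓ` ramified in `ℚ(√d)` (`RamifiedInQuadratic d ℓ`: `ℓ ∣ d`, or `ℓ = 2 ∧ d ≢ 1 (mod 4)`): `ℓ % p ≠ 1` and
`p ∤ a_ℓ(W₀)² − (ℓ + 1)²`. DECIDED IN THE KERNEL from: `|d|` square-free as a bounded check; a list `L` of pairs `(q, n_q)`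
covering the odd prime factors of `|d|`, each with `q` prime, `q ≠ 2`, `q ∤ Δ₀`, `q % p ≠ 1`, `countPoints [b] q = n_q`
and `p ∤ (q + 1 − n_q)² − (q + 1)²` (§1); and, only when `d ≢ 1 (mod 4)`, `2 ∤ Δ₀`, `2 % p ≠ 1` and the same check on the
𝔽₂-count. UNCONDITIONAL; per pair; nothing booked. [cite: PollackWeston2011, Thm. 6.8 (Compositio Math. 147; shape of the level-raising condition only, nothing asserted)]
[cite: SilvermanAEC2009, V.2 (a = q + 1 − #E(𝔽_q), PDF p. 147)] -/
theorem nlr_of_certs (d : ℤ) (hd : ∀ q < d.natAbs + 1, 2 ≤ q → ¬ q * q ∣ d.natAbs) (hd0 : d ≠ 0)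
    (L : List (ℕ × ℕ)) (hLcov : ∀ q < d.natAbs + 1, q.Prime → q ∣ d.natAbs → q = 2 ∨ q ∈ L.map Prod.fst)
    (hL : ∀ qn ∈ L, qn.1.Prime ∧ qn.1 ≠ 2 ∧ ¬ (qn.1 : ℤ) ∣ discOf [b1, b2, b3, b4, b6] ∧ qn.1 % p ≠ 1 ∧
      countPoints [b1, b2, b3, b4, b6] qn.1 = qn.2 ∧
      ¬ (p : ℤ) ∣ ((qn.1 : ℤ) + 1 - qn.2) ^ 2 - ((qn.1 : ℤ) + 1) ^ 2)
    (h2 : d % 4 ≠ 1 → ¬ (2 : ℤ) ∣ discOf [b1, b2, b3, b4, b6] ∧ 2 % p ≠ 1 ∧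
      ¬ (p : ℤ) ∣ (3 - ((1 + Fintype.card {xy : ZMod 2 × ZMod 2 //
      xy.2 ^ 2 + ((⟨b1, b2, b3, b4, b6⟩ : WeierstrassCurve ℤ).map (Int.castRingHom (ZMod 2))).a₁ * xy.1 * xy.2 +
        ((⟨b1, b2, b3, b4, b6⟩ : WeierstrassCurve ℤ).map (Int.castRingHom (ZMod 2))).a₃ * xy.2 =
      xy.1 ^ 3 + ((⟨b1, b2, b3, b4, b6⟩ : WeierstrassCurve ℤ).map (Int.castRingHom (ZMod 2))).a₂ * xy.1 ^ 2 +
        ((⟨b1, b2, b3, b4, b6⟩ : WeierstrassCurve ℤ).map (Int.castRingHom (ZMod 2))).a₄ * xy.1 +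
        ((⟨b1, b2, b3, b4, b6⟩ : WeierstrassCurve ℤ).map (Int.castRingHom (ZMod 2))).a₆} : ℕ) : ℤ)) ^ 2 - 9) :
    ∀ (ℓ : ℕ) [Fact ℓ.Prime], RamifiedInQuadratic d ℓ →
      ℓ % p ≠ 1 ∧ ¬ (p : ℤ) ∣ (⟨b1, b2, b3, b4, b6⟩ : WeierstrassCurve ℚ).frobeniusTrace ℓ ^ 2 - ((ℓ : ℤ) + 1) ^ 2 := by
  have hdn : Squarefree d.natAbs := by
    intro x hx
    have hn0 : d.natAbs ≠ 0 := Int.natAbs_ne_zero.mpr hd0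
    have hxle : x ≤ d.natAbs := Nat.le_of_dvd (Nat.pos_of_ne_zero hn0) (dvd_trans (dvd_mul_right x x) hx)
    by_contra hx1
    rw [Nat.isUnit_iff] at hx1
    have hx0 : x ≠ 0 := by rintro rfl; exact hn0 (Nat.eq_zero_of_zero_dvd (by simpa using hx))
    exact hd x (Nat.lt_succ_of_le hxle) (by omega) hx
  have hd' : Squarefree d := Int.squarefree_natAbs.mp hdn
  intro ℓ hℓ h
  rcases ramifiedInQuadratic_cases hd' hℓ.out h with ⟨rfl, hd4⟩ | ⟨hℓ2, hℓd, hℓlt⟩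
  · obtain ⟨h2Δ, h2p, hchk⟩ := h2 hd4
    refine ⟨h2p, ?_⟩
    rw [frobeniusTrace_two_eq_of_card b1 b2 b3 b4 b6 h2Δ]
    push_cast
    exact hchk
  · have hmem : ℓ ∈ L.map Prod.fst := (hLcov ℓ hℓlt hℓ.out hℓd).resolve_left hℓ2
    obtain ⟨qn, hqn, hq⟩ := List.mem_map.mp hmem
    obtain ⟨-, hq2, hqΔ, hqp, hcnt, hchk⟩ := hL qn hqn
    subst hq
    refine ⟨hqp, ?_⟩
    rw [frobeniusTrace_eq_of_countPoints b1 b2 b3 b4 b6 qn.1 hq2 hqΔ hcnt]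
    exact hchk

end NLR

/-! ### §3 The BODY twist datum WITH the (NLR) clause, from certificates -/

section Datum

variable (p : ℕ) [Fact p.Prime]
  (a1 a2 a3 a4 a6 b1 b2 b3 b4 b6 : ℤ)
  [hEb : (⟨b1, b2, b3, b4, b6⟩ : WeierstrassCurve ℚ).IsElliptic]
  [hMb : (⟨b1, b2, b3, b4, b6⟩ : WeierstrassCurve ℚ).IsGloballyMinimal]

/-- **The BODY twist datum of a pair WITH the (NLR) clause, from certificates** — the datum of
`exists_twistBody_of_certs` (`W₀` semistable, `p` good supersingular with `a_p(W₀) = 0`, `d` square-free `≠ 1`, ramified primes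
`≠ p` and good for `W₀`, `C • W = W₀^{(d)}`) AND, as an eighth conjunct, (NLR) at every prime of `d_K`
(`nlr_of_certs`). The two certificate lists are merged: `L : List (ℕ × ℕ)` of `(q, countPoints [b] q)` over the odd primes
of `|d|`. UNCONDITIONAL (a statement about two explicit equations and an integer); per pair; nothing booked; the scoped tier
that would consume the eighth conjunct (road B1″ / Moakher's route) is NOT typed at the time of writing — the desk's word first.
[cite: BurungaleSkinnerTianWan2024, Cor. 10.2 twist clause (p. 86) and §10.3 (tex l.7421–7428) (shape of the hypotheses only, nothing asserted)]
[cite: PollackWeston2011, Thm. 6.8 (shape of the level-raising condition only)] [cite: SilvermanAEC2009, III.1 Table 3.1, V.2, VII.5 Prop. 5.1] -/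
theorem exists_twistBodyNLR_of_certs (hp2 : p ≠ 2) (d : ℤ) (u r s t : ℚ) (hu : u ≠ 0)
    (h1 : (a1 : ℚ) + 2 * s = 0)
    (h2' : (a2 : ℚ) - s * a1 + 3 * r - s ^ 2 = u ^ 2 * ((d : ℚ) * ((b1 : ℚ) ^ 2 + 4 * b2) / 4))
    (h3 : (a3 : ℚ) + r * a1 + 2 * t = 0)
    (h4 : (a4 : ℚ) - s * a3 + 2 * r * a2 - (t + r * s) * a1 + 3 * r ^ 2 - 2 * s * t =
      u ^ 4 * ((d : ℚ) ^ 2 * (2 * (b4 : ℚ) + b1 * b3) / 2))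
    (h6 : (a6 : ℚ) + r * a4 + r ^ 2 * a2 + r ^ 3 - t * a3 - t ^ 2 - r * t * a1 =
      u ^ 6 * ((d : ℚ) ^ 3 * ((b3 : ℚ) ^ 2 + 4 * b6) / 4))
    (hgcd : Int.gcd (discOf [b1, b2, b3, b4, b6]) (c4Of [b1, b2, b3, b4, b6]) = 1)
    (hpΔ : ¬ (p : ℤ) ∣ discOf [b1, b2, b3, b4, b6]) (hcnt : countPoints [b1, b2, b3, b4, b6] p = (p + 1 : ℕ))
    (hd : ∀ q < d.natAbs + 1, 2 ≤ q → ¬ q * q ∣ d.natAbs) (hd0 : d ≠ 0) (hd1 : d ≠ 1) (L : List (ℕ × ℕ))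
    (hLcov : ∀ q < d.natAbs + 1, q.Prime → q ∣ d.natAbs → q = 2 ∨ q ∈ L.map Prod.fst)
    (hL : ∀ qn ∈ L, qn.1.Prime ∧ qn.1 ≠ 2 ∧ ¬ (qn.1 : ℤ) ∣ discOf [b1, b2, b3, b4, b6] ∧ qn.1 % p ≠ 1 ∧
      countPoints [b1, b2, b3, b4, b6] qn.1 = qn.2 ∧
      ¬ (p : ℤ) ∣ ((qn.1 : ℤ) + 1 - qn.2) ^ 2 - ((qn.1 : ℤ) + 1) ^ 2)
    (hLp : ∀ qn ∈ L, qn.1 ≠ p)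
    (h2 : d % 4 ≠ 1 → ¬ (2 : ℤ) ∣ discOf [b1, b2, b3, b4, b6] ∧ 2 % p ≠ 1 ∧
      ¬ (p : ℤ) ∣ (3 - ((1 + Fintype.card {xy : ZMod 2 × ZMod 2 //
      xy.2 ^ 2 + ((⟨b1, b2, b3, b4, b6⟩ : WeierstrassCurve ℤ).map (Int.castRingHom (ZMod 2))).a₁ * xy.1 * xy.2 +
        ((⟨b1, b2, b3, b4, b6⟩ : WeierstrassCurve ℤ).map (Int.castRingHom (ZMod 2))).a₃ * xy.2 =
      xy.1 ^ 3 + ((⟨b1, b2, b3, b4, b6⟩ : WeierstrassCurve ℤ).map (Int.castRingHom (ZMod 2))).a₂ * xy.1 ^ 2 +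
        ((⟨b1, b2, b3, b4, b6⟩ : WeierstrassCurve ℤ).map (Int.castRingHom (ZMod 2))).a₄ * xy.1 +
        ((⟨b1, b2, b3, b4, b6⟩ : WeierstrassCurve ℤ).map (Int.castRingHom (ZMod 2))).a₆} : ℕ) : ℤ)) ^ 2 - 9) :
    ∃ (W₀ : WeierstrassCurve ℚ) (_ : W₀.IsElliptic) (_ : W₀.IsGloballyMinimal) (d : ℤ) (C : VariableChange ℚ),
      Semistable W₀ ∧ GoodSS W₀ p ∧ W₀.frobeniusTrace p = 0 ∧ Squarefree d ∧ d ≠ 1 ∧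
      (∀ (q : ℕ) [Fact q.Prime], RamifiedInQuadratic d q → q ≠ p ∧ W₀.HasGoodReductionAtPrime q) ∧
      C • (⟨a1, a2, a3, a4, a6⟩ : WeierstrassCurve ℚ) = W₀.quadraticTwist (d : ℚ) ∧
      (∀ (ℓ : ℕ) [Fact ℓ.Prime], RamifiedInQuadratic d ℓ →
        ℓ % p ≠ 1 ∧ ¬ (p : ℤ) ∣ W₀.frobeniusTrace ℓ ^ 2 - ((ℓ : ℤ) + 1) ^ 2) := by
  have hNLR := nlr_of_certs p b1 b2 b3 b4 b6 d hd hd0 L hLcov hL h2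
  have hIb := integralModelInt_lit b1 b2 b3 b4 b6
  have hsst := semistable_of_certs b1 b2 b3 b4 b6 hgcd
  have hss := goodSS_of_certs b1 b2 b3 b4 b6 p hp2 hpΔ hcnt
  have hap := frobeniusTrace_eq_zero_of_certs b1 b2 b3 b4 b6 p hp2 hpΔ hcnt
  have hdn : Squarefree d.natAbs := by
    intro x hx
    have hn0 : d.natAbs ≠ 0 := Int.natAbs_ne_zero.mpr hd0
    have hxle : x ≤ d.natAbs := Nat.le_of_dvd (Nat.pos_of_ne_zero hn0) (dvd_trans (dvd_mul_right x x) hx)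
    by_contra hx1
    rw [Nat.isUnit_iff] at hx1
    have hx0 : x ≠ 0 := by rintro rfl; exact hn0 (Nat.eq_zero_of_zero_dvd (by simpa using hx))
    exact hd x (Nat.lt_succ_of_le hxle) (by omega) hx
  have hd' : Squarefree d := Int.squarefree_natAbs.mp hdn
  have hgoodq : ∀ (q : ℕ) [Fact q.Prime], ¬ (q : ℤ) ∣ discOf [b1, b2, b3, b4, b6] →
      (⟨b1, b2, b3, b4, b6⟩ : WeierstrassCurve ℚ).HasGoodReductionAtPrime q := fun q _ hqΔ ↦
    hasGoodReductionAtPrime_of_not_dvd _ q (by rw [minimalDiscriminantInt_eq hIb, intCurve_Δ]; exact hqΔ)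
  have hram : ∀ (q : ℕ) [Fact q.Prime], RamifiedInQuadratic d q →
      q ≠ p ∧ (⟨b1, b2, b3, b4, b6⟩ : WeierstrassCurve ℚ).HasGoodReductionAtPrime q := by
    intro q hq h
    rcases ramifiedInQuadratic_cases hd' hq.out h with ⟨rfl, hd4⟩ | ⟨hq2, hqd, hqlt⟩
    · exact ⟨Ne.symm hp2, hgoodq 2 (h2 hd4).1⟩
    · have hmem : q ∈ L.map Prod.fst := (hLcov q hqlt hq.out hqd).resolve_left hq2
      obtain ⟨qn, hqn, rfl⟩ := List.mem_map.mp hmem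
      obtain ⟨-, -, hqΔ, -⟩ := hL qn hqn
      exact ⟨hLp qn hqn, hgoodq qn.1 hqΔ⟩
  have hC := smul_eq_quadraticTwist_of_eqs a1 a2 a3 a4 a6 b1 b2 b3 b4 b6 d u r s t hu h1 h2' h3 h4 h6
  exact ⟨_, hEb, hMb, d, _, hsst, hss, hap, hd', hd1, hram, hC, hNLR⟩

end Datum

end Summit.BirchSwinnertonDyer.BirchSwinnertonDyer.Theorems.X7Twist

end
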